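import Summits.QuantumFields.YangMills.Theorems.UnitScaleTiltProp7GramDifferenceNearFarSplit
import HarnessLib

/-!
# Route `UnitScaleTilt`, crux K1 «MinimiserStabilityRegPr» (stmt-QuantumFields-19200), EX row `hGF[Lift]` (curved member) — **LOD LINE, PEN (L5″) (RN-far) (ABSTRACT):
# THE FAR TAIL OF THE GRAM-INVERSE COORDINATES** — the `htail` binder of ✓`Prop7GramDifferenceNearFarSplit.gramDifference_row_of_near_far` (routeR-w3 g12's 2r-door) ∕
# ✓`Prop7GramDifferenceRowSum.hRN_of_near_far` as a statement about FINITE SUMS: for coordinates `c_y = Σ_{y′} N_{yy′}·b_{y′}` with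
# * an index kernel decaying in an index pseudo-distance, `‖N_{yy′}‖ ≤ C_N·e^{−μ′·e(y,y′)}` (at the member: ✓`Prop7CoarseGramInverseDecay.norm_gram_inv_spike_le_exp_neg_tdist` for the
#   flat Gram `M′`, `e(y,y′) = tdist(σ y.1, σ y′.1)`),
# * a source localised at a block set `S` with block weights `w`, `‖b_{y′}‖ ≤ Σ_{z ∈ S} A·e^{−μ·d(y′,z)}·w_z` (at the member: the column localisation
#   ✓`Prop7ComplementaryProjectorBlockDecay.norm_inner_spike_column_le` of `b_f(y′) = ⟪G_W(T_W(b_{y′})), f⟫` for `f = Σ_{z∈S} f_z` block-decomposed, `w_z = ‖f_z‖`, `d(y′,z) = tdist(z, σ y′.1)`),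
# * the triangle inequality `d(y,z) ≤ e(y,y′) + d(y′,z)` and the coarse volumes `Σ_{y′} e^{−ν·d(y′,z)} ≤ V` (✓`Prop7BlockDistanceWeights` (W2)(W3)),
# every index `y` that is `r`-far from `S` (`∀ z ∈ S, r ≤ d(y,z)`) has `‖c_y‖ ≤ C_N·A·V·e^{−μ′r∕2}·Σ_{z∈S} e^{−μ′d(y,z)∕2}·w_z`, and summing the squares with Cauchy–Schwarz:
# **`Σ_{y ∉ N} ‖c_y‖² ≤ (C_N·A·V)²·V′·V″·e^{−μ′·r}·Σ_{z∈S} w_z²`** for any `N` containing every index that is not `r`-far — i.e.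
# **`√Σ_y‖(if y ∈ N then 0 else c_y)‖² ≤ C_N·A·V·√(V′V″)·e^{−μ′r∕2}·√Σ_{z∈S} w_z²`**, the `htail` shape with `τ := C_N·A·V·√(V′V″)·e^{−μ′r∕2}` once `√Σ_{z∈S} w_z² = ‖f‖`.

Cell `ym3-torus` (HUMAN RULING D-0037, YM ladder rung R3 — NOT d = 4, NOT infinite volume, NOT a mass gap, NOT Clay).  Width seat `ym-routeR-w2` gen 13 (routeR-w3 g12
2026-08-30 01:54:13Z «(RN-far) the tail `‖(M_1⁻¹b)|_{N^c}‖ ≤ τ‖f‖` (routeR-w2 ✓p753397 × ✓p753767 × ✓p752577∕✓p754074 volumes)»).  THEOREMS ONLY (0 `def`, 0 `sorry`), Mathlib only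
(via ✓`Prop7GramDifferenceNearFarSplit`); `--supports stmt-QuantumFields-19200 --as helper`, count-neutral.  HONEST LABEL (★★OWNER RULING №33 (6)): curved γ-row supplier line (LOD
localisation), pen (L5″); finite sums in hypothesis form — nothing of (RN) at the member, (3.49), Thm 3.1∕3.3, `h349`, `hGF`, EX ∕ 19200 is proved here.

WHAT IS PROVED (ns `Summit.QuantumFields.YangMills.Theorems.Prop7GramInverseFarTail`).
* §1 `exp_kernel_convolution_le` (`Σ_{y′} e^{−μ′e(y,y′)}·e^{−μd(y′,z)} ≤ V·e^{−μ′d(y,z)}`), ★★ `norm_coord_le_of_decay` (the pointwise row `‖c_y‖ ≤ C_N·A·V·Σ_{z∈S} e^{−μ′d(y,z)}·w_z`).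
* §2 `sq_sum_mul_le_sum_mul_sum_mul_sq` (weighted Cauchy–Schwarz), `exp_neg_mul_le_of_far` (`r ≤ d ⟹ e^{−μ′d} ≤ e^{−μ′r∕2}·e^{−(μ′∕2)d}`),
  ★★ `normSq_coord_le_of_far` (one far index), ★★★ `sum_normSq_far_coords_le` (the squared tail), ★★★ `sqrt_sum_normSq_far_coords_le` (the `htail` shape).

References: T. Bałaban, CMP **99** (1985) 389–434 [Balaban1985BackgroundPropagators] ((3.21)–(3.26) pp.394–395, (3.105)–(3.106) p.414); CMP **98** (1985) 17–51 [Balaban1985Averaging]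
((2) p.17).
-/

set_option autoImplicit false

noncomputable section

open scoped BigOperators Matrix

namespace Summit.QuantumFields.YangMills.Theorems.Prop7GramInverseFarTail

variable {ι κ : Type*} [Fintype ι] [DecidableEq ι] [DecidableEq κ]

/-! ## §1 The pointwise row: kernel decay ∗ localised source -/

omit [DecidableEq ι] [DecidableEq κ] in
/-- **CONVOLUTION OF TWO EXPONENTIAL KERNELS THROUGH THE TRIANGLE INEQUALITY**: `0 ≤ μ′ ≤ μ`, `d(y,z) ≤ e(y,y′) + d(y′,z)` and the volume `Σ_{y′} e^{−(μ−μ′)·d(y′,z)} ≤ V` give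
`Σ_{y′} e^{−μ′·e(y,y′)}·e^{−μ·d(y′,z)} ≤ V·e^{−μ′·d(y,z)}`. [cite: Balaban1985BackgroundPropagators, (3.23)–(3.26) pp.394–395] -/
theorem exp_kernel_convolution_le (d : ι → κ → ℝ) (e : ι → ι → ℝ) (htri : ∀ y y' z, d y z ≤ e y y' + d y' z)
    {μ μ' V : ℝ} (hμ' : 0 ≤ μ') (hV : ∀ z, ∑ y', Real.exp (-((μ - μ') * d y' z)) ≤ V) (y : ι) (z : κ) :
    ∑ y', Real.exp (-(μ' * e y y')) * Real.exp (-(μ * d y' z)) ≤ V * Real.exp (-(μ' * d y z)) := by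
  have hpt : ∀ y', Real.exp (-(μ' * e y y')) * Real.exp (-(μ * d y' z)) ≤ Real.exp (-((μ - μ') * d y' z)) * Real.exp (-(μ' * d y z)) := by
    intro y'
    rw [← Real.exp_add, ← Real.exp_add]
    refine Real.exp_le_exp.mpr ?_
    have := mul_le_mul_of_nonneg_left (htri y y' z) hμ'
    nlinarith
  calc ∑ y', Real.exp (-(μ' * e y y')) * Real.exp (-(μ * d y' z))
      ≤ ∑ y', Real.exp (-((μ - μ') * d y' z)) * Real.exp (-(μ' * d y z)) := Finset.sum_le_sum fun y' _ => hpt y'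
    _ = (∑ y', Real.exp (-((μ - μ') * d y' z))) * Real.exp (-(μ' * d y z)) := by rw [Finset.sum_mul]
    _ ≤ V * Real.exp (-(μ' * d y z)) := mul_le_mul_of_nonneg_right (hV z) (Real.exp_nonneg _)

omit [DecidableEq ι] [DecidableEq κ] in
/-- ★★ **THE POINTWISE ROW**: `‖N_{yy′}‖ ≤ C_N·e^{−μ′e(y,y′)}`, `‖b_{y′}‖ ≤ Σ_{z∈S} A·e^{−μ d(y′,z)}·w_z` (`w ≥ 0`), triangle + volume as in `exp_kernel_convolution_le` ⟹
**`‖Σ_{y′} N_{yy′}·b_{y′}‖ ≤ C_N·A·V·Σ_{z∈S} e^{−μ′·d(y,z)}·w_z`**. [cite: Balaban1985BackgroundPropagators, (3.21)–(3.26) pp.394–395, (3.105)–(3.106) p.414] -/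
theorem norm_coord_le_of_decay (d : ι → κ → ℝ) (e : ι → ι → ℝ) (htri : ∀ y y' z, d y z ≤ e y y' + d y' z)
    (Nm : ι → ι → ℂ) (bv : ι → ℂ) (S : Finset κ) (w : κ → ℝ) (hw : ∀ z, 0 ≤ w z)
    {CN A μ μ' V : ℝ} (hCN : 0 ≤ CN) (hA : 0 ≤ A) (hμ' : 0 ≤ μ')
    (hN : ∀ y y', ‖Nm y y'‖ ≤ CN * Real.exp (-(μ' * e y y'))) (hb : ∀ y', ‖bv y'‖ ≤ ∑ z ∈ S, A * Real.exp (-(μ * d y' z)) * w z)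
    (hV : ∀ z, ∑ y', Real.exp (-((μ - μ') * d y' z)) ≤ V) (y : ι) :
    ‖∑ y', Nm y y' * bv y'‖ ≤ CN * A * V * ∑ z ∈ S, Real.exp (-(μ' * d y z)) * w z := by
  calc ‖∑ y', Nm y y' * bv y'‖ ≤ ∑ y', ‖Nm y y' * bv y'‖ := norm_sum_le _ _
    _ ≤ ∑ y', (CN * Real.exp (-(μ' * e y y'))) * (∑ z ∈ S, A * Real.exp (-(μ * d y' z)) * w z) := by
        refine Finset.sum_le_sum fun y' _ => ?_
        rw [norm_mul]
        exact mul_le_mul (hN y y') (hb y') (norm_nonneg _) (mul_nonneg hCN (Real.exp_nonneg _))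
    _ = CN * A * ∑ z ∈ S, w z * ∑ y', Real.exp (-(μ' * e y y')) * Real.exp (-(μ * d y' z)) := by
        simp_rw [Finset.mul_sum]
        rw [Finset.sum_comm]
        refine Finset.sum_congr rfl fun z _ => Finset.sum_congr rfl fun y' _ => by ring
    _ ≤ CN * A * ∑ z ∈ S, w z * (V * Real.exp (-(μ' * d y z))) := by
        refine mul_le_mul_of_nonneg_left (Finset.sum_le_sum fun z _ => ?_) (mul_nonneg hCN hA)
        exact mul_le_mul_of_nonneg_left (exp_kernel_convolution_le d e htri hμ' hV y z) (hw z)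
    _ = CN * A * V * ∑ z ∈ S, Real.exp (-(μ' * d y z)) * w z := by
        rw [mul_assoc (CN * A) V, Finset.mul_sum, Finset.mul_sum, Finset.mul_sum]
        refine Finset.sum_congr rfl fun z _ => by ring

/-! ## §2 The far tail: separation, Cauchy–Schwarz, volumes -/

omit [Fintype ι] [DecidableEq ι] [DecidableEq κ] in
/-- **WEIGHTED CAUCHY–SCHWARZ**: for `a ≥ 0`, `(Σ_{z∈S} a_z·w_z)² ≤ (Σ_{z∈S} a_z)·(Σ_{z∈S} a_z·w_z²)`. [folklore] -/
theorem sq_sum_mul_le_sum_mul_sum_mul_sq (S : Finset κ) (a w : κ → ℝ) (ha : ∀ z, 0 ≤ a z) :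
    (∑ z ∈ S, a z * w z) ^ 2 ≤ (∑ z ∈ S, a z) * ∑ z ∈ S, a z * w z ^ 2 :=
  Finset.sum_sq_le_sum_mul_sum_of_sq_le_mul S (fun z _ => ha z) (fun z _ => mul_nonneg (ha z) (sq_nonneg _)) fun z _ => by
    rw [mul_pow]; nlinarith [ha z, sq_nonneg (w z)]

/-- **SEPARATION**: `0 ≤ μ′`, `r ≤ d` ⟹ `e^{−μ′·d} ≤ e^{−μ′·r∕2}·e^{−(μ′∕2)·d}`. [folklore] -/
theorem exp_neg_mul_le_of_far {μ' r d : ℝ} (hμ' : 0 ≤ μ') (hrd : r ≤ d) :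
    Real.exp (-(μ' * d)) ≤ Real.exp (-(μ' * r / 2)) * Real.exp (-(μ' / 2 * d)) := by
  rw [← Real.exp_add]
  refine Real.exp_le_exp.mpr ?_
  nlinarith [mul_le_mul_of_nonneg_left hrd hμ']

omit [DecidableEq ι] [DecidableEq κ] in
/-- ★★ **ONE FAR INDEX**: under the hypotheses of `norm_coord_le_of_decay`, if `y` is `r`-far from `S` (`∀ z ∈ S, r ≤ d(y,z)`) and `Σ_{z∈S} e^{−(μ′∕2)d(y,z)} ≤ V′`, then
`‖Σ_{y′} N_{yy′}b_{y′}‖² ≤ (C_N·A·V)²·e^{−μ′r}·V′·Σ_{z∈S} e^{−(μ′∕2)d(y,z)}·w_z²`. [cite: Balaban1985BackgroundPropagators, (3.23)–(3.26) pp.394–395, (3.105)–(3.106) p.414] -/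
theorem normSq_coord_le_of_far (d : ι → κ → ℝ) (e : ι → ι → ℝ) (htri : ∀ y y' z, d y z ≤ e y y' + d y' z)
    (Nm : ι → ι → ℂ) (bv : ι → ℂ) (S : Finset κ) (w : κ → ℝ) (hw : ∀ z, 0 ≤ w z)
    {CN A μ μ' V V' r : ℝ} (hCN : 0 ≤ CN) (hA : 0 ≤ A) (hμ' : 0 ≤ μ') (hV0 : 0 ≤ V)
    (hN : ∀ y y', ‖Nm y y'‖ ≤ CN * Real.exp (-(μ' * e y y'))) (hb : ∀ y', ‖bv y'‖ ≤ ∑ z ∈ S, A * Real.exp (-(μ * d y' z)) * w z)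
    (hV : ∀ z, ∑ y', Real.exp (-((μ - μ') * d y' z)) ≤ V) (y : ι) (hfar : ∀ z ∈ S, r ≤ d y z)
    (hV' : ∑ z ∈ S, Real.exp (-(μ' / 2 * d y z)) ≤ V') :
    ‖∑ y', Nm y y' * bv y'‖ ^ 2 ≤ (CN * A * V) ^ 2 * Real.exp (-(μ' * r)) * V' * ∑ z ∈ S, Real.exp (-(μ' / 2 * d y z)) * w z ^ 2 := by
  have h1 := norm_coord_le_of_decay d e htri Nm bv S w hw hCN hA hμ' hN hb hV y
  have hsep : ∑ z ∈ S, Real.exp (-(μ' * d y z)) * w z ≤ Real.exp (-(μ' * r / 2)) * ∑ z ∈ S, Real.exp (-(μ' / 2 * d y z)) * w z := by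
    rw [Finset.mul_sum]
    refine Finset.sum_le_sum fun z hz => ?_
    rw [← mul_assoc]
    exact mul_le_mul_of_nonneg_right (exp_neg_mul_le_of_far hμ' (hfar z hz)) (hw z)
  have hK : 0 ≤ CN * A * V := mul_nonneg (mul_nonneg hCN hA) hV0
  have h2 : ‖∑ y', Nm y y' * bv y'‖ ≤ CN * A * V * (Real.exp (-(μ' * r / 2)) * ∑ z ∈ S, Real.exp (-(μ' / 2 * d y z)) * w z) :=
    h1.trans (mul_le_mul_of_nonneg_left hsep hK)
  have hS0 : 0 ≤ ∑ z ∈ S, Real.exp (-(μ' / 2 * d y z)) * w z := Finset.sum_nonneg fun z _ => mul_nonneg (Real.exp_nonneg _) (hw z)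
  have hCS := sq_sum_mul_le_sum_mul_sum_mul_sq S (fun z => Real.exp (-(μ' / 2 * d y z))) w fun z => Real.exp_nonneg _
  have hsq : Real.exp (-(μ' * r / 2)) ^ 2 = Real.exp (-(μ' * r)) := by rw [← Real.exp_nat_mul]; congr 1; ring
  calc ‖∑ y', Nm y y' * bv y'‖ ^ 2 ≤ (CN * A * V * (Real.exp (-(μ' * r / 2)) * ∑ z ∈ S, Real.exp (-(μ' / 2 * d y z)) * w z)) ^ 2 :=
        pow_le_pow_left₀ (norm_nonneg _) h2 2
    _ = (CN * A * V) ^ 2 * Real.exp (-(μ' * r)) * (∑ z ∈ S, Real.exp (-(μ' / 2 * d y z)) * w z) ^ 2 := by simp only [mul_pow]; rw [hsq]; ring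
    _ ≤ (CN * A * V) ^ 2 * Real.exp (-(μ' * r)) * ((∑ z ∈ S, Real.exp (-(μ' / 2 * d y z))) * ∑ z ∈ S, Real.exp (-(μ' / 2 * d y z)) * w z ^ 2) :=
        mul_le_mul_of_nonneg_left hCS (mul_nonneg (sq_nonneg _) (Real.exp_nonneg _))
    _ ≤ (CN * A * V) ^ 2 * Real.exp (-(μ' * r)) * (V' * ∑ z ∈ S, Real.exp (-(μ' / 2 * d y z)) * w z ^ 2) := by
        refine mul_le_mul_of_nonneg_left ?_ (mul_nonneg (sq_nonneg _) (Real.exp_nonneg _))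
        exact mul_le_mul_of_nonneg_right hV' (Finset.sum_nonneg fun z _ => mul_nonneg (Real.exp_nonneg _) (sq_nonneg _))
    _ = (CN * A * V) ^ 2 * Real.exp (-(μ' * r)) * V' * ∑ z ∈ S, Real.exp (-(μ' / 2 * d y z)) * w z ^ 2 := by ring

omit [DecidableEq κ] in
/-- ★★★ **THE SQUARED FAR TAIL**: under the hypotheses of `norm_coord_le_of_decay`, with a finite set `N` of indices containing every index that is NOT `r`-far from `S`
(`∀ y ∉ N, ∀ z ∈ S, r ≤ d(y,z)`) and the two half-slope volumes `Σ_{z∈S} e^{−(μ′∕2)d(y,z)} ≤ V′` (every `y`), `Σ_y e^{−(μ′∕2)d(y,z)} ≤ V″` (every `z`):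
**`Σ_y ‖(if y ∈ N then 0 else Σ_{y′} N_{yy′}b_{y′})‖² ≤ (C_N·A·V)²·V′·V″·e^{−μ′r}·Σ_{z∈S} w_z²`**.
[cite: Balaban1985BackgroundPropagators, (3.21)–(3.26) pp.394–395, (3.105)–(3.106) p.414; Balaban1985Averaging, (2) p.17] -/
theorem sum_normSq_far_coords_le (d : ι → κ → ℝ) (e : ι → ι → ℝ) (htri : ∀ y y' z, d y z ≤ e y y' + d y' z)
    (Nm : ι → ι → ℂ) (bv : ι → ℂ) (S : Finset κ) (w : κ → ℝ) (hw : ∀ z, 0 ≤ w z)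
    {CN A μ μ' V V' V'' r : ℝ} (hCN : 0 ≤ CN) (hA : 0 ≤ A) (hμ' : 0 ≤ μ') (hV0 : 0 ≤ V) (hV'0 : 0 ≤ V')
    (hN : ∀ y y', ‖Nm y y'‖ ≤ CN * Real.exp (-(μ' * e y y'))) (hb : ∀ y', ‖bv y'‖ ≤ ∑ z ∈ S, A * Real.exp (-(μ * d y' z)) * w z)
    (hV : ∀ z, ∑ y', Real.exp (-((μ - μ') * d y' z)) ≤ V)
    (N : Finset ι) (hfar : ∀ y, y ∉ N → ∀ z ∈ S, r ≤ d y z)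
    (hV' : ∀ y, ∑ z ∈ S, Real.exp (-(μ' / 2 * d y z)) ≤ V') (hV'' : ∀ z, ∑ y, Real.exp (-(μ' / 2 * d y z)) ≤ V'') :
    ∑ y, ‖(if y ∈ N then (0 : ℂ) else ∑ y', Nm y y' * bv y')‖ ^ 2 ≤ (CN * A * V) ^ 2 * V' * V'' * Real.exp (-(μ' * r)) * ∑ z ∈ S, w z ^ 2 := by
  have hpt : ∀ y, ‖(if y ∈ N then (0 : ℂ) else ∑ y', Nm y y' * bv y')‖ ^ 2
      ≤ (CN * A * V) ^ 2 * Real.exp (-(μ' * r)) * V' * ∑ z ∈ S, Real.exp (-(μ' / 2 * d y z)) * w z ^ 2 := by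
    intro y
    by_cases hy : y ∈ N
    · rw [if_pos hy, norm_zero, zero_pow two_ne_zero]
      exact mul_nonneg (mul_nonneg (mul_nonneg (sq_nonneg _) (Real.exp_nonneg _)) hV'0)
        (Finset.sum_nonneg fun z _ => mul_nonneg (Real.exp_nonneg _) (sq_nonneg _))
    · rw [if_neg hy]
      exact normSq_coord_le_of_far d e htri Nm bv S w hw hCN hA hμ' hV0 hN hb hV y (hfar y hy) (hV' y)
  calc ∑ y, ‖(if y ∈ N then (0 : ℂ) else ∑ y', Nm y y' * bv y')‖ ^ 2
      ≤ ∑ y, (CN * A * V) ^ 2 * Real.exp (-(μ' * r)) * V' * ∑ z ∈ S, Real.exp (-(μ' / 2 * d y z)) * w z ^ 2 := Finset.sum_le_sum fun y _ => hpt y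
    _ = (CN * A * V) ^ 2 * Real.exp (-(μ' * r)) * V' * ∑ z ∈ S, w z ^ 2 * ∑ y, Real.exp (-(μ' / 2 * d y z)) := by
        rw [← Finset.mul_sum, Finset.sum_comm]
        congr 1
        refine Finset.sum_congr rfl fun z _ => ?_
        rw [Finset.mul_sum]
        exact Finset.sum_congr rfl fun y _ => mul_comm _ _
    _ ≤ (CN * A * V) ^ 2 * Real.exp (-(μ' * r)) * V' * ∑ z ∈ S, w z ^ 2 * V'' := by
        refine mul_le_mul_of_nonneg_left (Finset.sum_le_sum fun z _ => mul_le_mul_of_nonneg_left (hV'' z) (sq_nonneg _)) ?_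
        exact mul_nonneg (mul_nonneg (sq_nonneg _) (Real.exp_nonneg _)) hV'0
    _ = (CN * A * V) ^ 2 * V' * V'' * Real.exp (-(μ' * r)) * ∑ z ∈ S, w z ^ 2 := by rw [← Finset.sum_mul]; ring

omit [DecidableEq κ] in
/-- ★★★ **THE FAR TAIL IN `Real.sqrt` CURRENCY** (the `htail` shape of ✓`Prop7GramDifferenceNearFarSplit.gramDifference_row_of_near_far` ∕
✓`Prop7GramDifferenceRowSum.hRN_of_near_far`, with `c = N b`): under the hypotheses of `sum_normSq_far_coords_le`,
**`√Σ_y‖(if y ∈ N then 0 else (N b)_y)‖² ≤ (C_N·A·V·√(V′·V″)·e^{−μ′r∕2})·√Σ_{z∈S} w_z²`** — at the member `√Σ_{z∈S} w_z² = ‖f‖`, so `τ := C_N·A·V·√(V′V″)·e^{−μ′r∕2}`.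
[cite: Balaban1985BackgroundPropagators, (3.21)–(3.26) pp.394–395, (3.105)–(3.106) p.414; Balaban1985Averaging, (2) p.17] -/
theorem sqrt_sum_normSq_far_coords_le (d : ι → κ → ℝ) (e : ι → ι → ℝ) (htri : ∀ y y' z, d y z ≤ e y y' + d y' z)
    (Nm : Matrix ι ι ℂ) (bv : ι → ℂ) (S : Finset κ) (w : κ → ℝ) (hw : ∀ z, 0 ≤ w z)
    {CN A μ μ' V V' V'' r : ℝ} (hCN : 0 ≤ CN) (hA : 0 ≤ A) (hμ' : 0 ≤ μ') (hV0 : 0 ≤ V) (hV'0 : 0 ≤ V') (hV''0 : 0 ≤ V'')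
    (hN : ∀ y y', ‖Nm y y'‖ ≤ CN * Real.exp (-(μ' * e y y'))) (hb : ∀ y', ‖bv y'‖ ≤ ∑ z ∈ S, A * Real.exp (-(μ * d y' z)) * w z)
    (hV : ∀ z, ∑ y', Real.exp (-((μ - μ') * d y' z)) ≤ V)
    (N : Finset ι) (hfar : ∀ y, y ∉ N → ∀ z ∈ S, r ≤ d y z)
    (hV' : ∀ y, ∑ z ∈ S, Real.exp (-(μ' / 2 * d y z)) ≤ V') (hV'' : ∀ z, ∑ y, Real.exp (-(μ' / 2 * d y z)) ≤ V'') :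
    Real.sqrt (∑ y, ‖(if y ∈ N then (0 : ℂ) else (Nm *ᵥ bv) y)‖ ^ 2)
      ≤ (CN * A * V * Real.sqrt (V' * V'') * Real.exp (-(μ' * r / 2))) * Real.sqrt (∑ z ∈ S, w z ^ 2) := by
  have h := sum_normSq_far_coords_le d e htri Nm bv S w hw hCN hA hμ' hV0 hV'0 hN hb hV N hfar hV' hV''
  have hmv : ∀ y, (Nm *ᵥ bv) y = ∑ y', Nm y y' * bv y' := fun y => rfl
  simp_rw [hmv]
  have hK : 0 ≤ CN * A * V * Real.sqrt (V' * V'') * Real.exp (-(μ' * r / 2)) := by positivity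
  rw [← Real.sqrt_sq hK, ← Real.sqrt_mul (sq_nonneg _)]
  refine Real.sqrt_le_sqrt (h.trans (le_of_eq ?_))
  have e1 : Real.sqrt (V' * V'') ^ 2 = V' * V'' := Real.sq_sqrt (mul_nonneg hV'0 hV''0)
  have e2 : Real.exp (-(μ' * r / 2)) ^ 2 = Real.exp (-(μ' * r)) := by rw [← Real.exp_nat_mul]; congr 1; push_cast; ring
  simp only [mul_pow, e1, e2]; ring

end Summit.QuantumFields.YangMills.Theorems.Prop7GramInverseFarTail

end
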